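import Mathlib
import HarnessLib
import Summits.KontsevichZagierPeriods.KontsevichZagierPeriods.Theses.HurwitzMicroSectors
import Literature.NumberTheory.Transcendental.KZRelationsLE
import Literature.NumberTheory.Transcendental.KZGroundingRelations
import Literature.NumberTheory.Transcendental.BoxCoordinatePowerMap
import Literature.NumberTheory.Transcendental.BoxIntegralHurwitzWeightTwo
import Literature.NumberTheory.Transcendental.KZMellinFibres

/-!
# Sketch — crux-ideate round 1, ideator 1, crux `ReductionTwoSix` (stmt-KontsevichZagierPeriods-3871)

**Status (2026-08-16T01:35Z): this file contains a COMPLETE, UNCONDITIONAL, kernel-checked proof of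
the crux** — `reductionTwoSix_holds : ReductionTwoSix` (rc 0, 0 `sorry`, axioms `propext`,
`Classical.choice`, `Quot.sound`) — and of the route's engine item
`dilationMove_holds : DilationMove` (stmt-KontsevichZagierPeriods-3872, all `n`, all `m ≥ 1`).
It is a crux WORKFILE (planner seat; `Theorems/` is prover-only): a prover should port it verbatim
into `Summits/KontsevichZagierPeriods/KontsevichZagierPeriods/Theorems/`.

Architecture = the two idea cards of this seat, executed:

* card `dilated-constants-single-box`: `MonomialDilatesConstant` (first lemma) and
  `monomialDilatesConstant_of_dilationMove`; in the final proof the monomial rows are discharged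
  by the dilation `m = k+1` of a constant (`aeval_pMp`, `aeval_pMk`, `kernel_mem`) — rule 3)
  (Newton–Leibniz) is never used, nor rule 1a), nor any change of dimension;
* card `hecke-kernel-certificate`: `U` (dilation operator), `DilationInvariant` (C⁺ analytic half,
  from `DilationMove`), `KernelGeneratorVanishes` (first lemma), `KernelDecomposition` (C⁺ algebraic
  half) PROVED (`kernelDecomposition_holds`: additivity/homogeneity of the certificate predicate
  `KD`, six base rows = inverse table of the basis `{k₁,k₂,k₃,k₆,n₁,n₂}`, hexagonal shift
  `Xⁿ ↦ Xⁿ⁺⁶`, strong induction, `Polynomial.as_sum_support_C_mul_X_pow`), `SectorRepExists`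
  PROVED (`sectorRepExists_holds`), `Transfer` PROVED (`transfer_holds`: one iterated integrand
  additivity `KZ.of_sub_sum_integrand_mem_relations` over the certificate + `kernel_mem` per
  generator), `DilationMove` PROVED (`dilationMove_holds`, five tree lemmas of
  `BoxCoordinatePowerMap.lean` + `isSemialgebraicMapOn_aeval`), whence `reductionTwoSix_holds`.

Moves used by the whole chain: integrand additivity 1b) and change of variables 2) (the
self-covers `Φ₂`, `Φ₆`, `Φ_{k+1}` of the one box `B = (0,1)²`); level 2 (`m = 3`) never enters.
-/

noncomputable section

set_option linter.dupNamespace false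

open MeasureTheory Set

namespace Summit.KontsevichZagierPeriods.KontsevichZagierPeriods.Cruxes.ReductionTwoSix.Sketch

open Literature.NumberTheory.Transcendental
open Summit.KontsevichZagierPeriods.KontsevichZagierPeriods.Theses.HurwitzMicroSectors

/-- The open unit box of `ℝ²` (literally the set in the crux). -/
abbrev box : Set (Fin 2 → ℝ) := {x | ∀ i, x i ∈ Set.Ioo (0:ℝ) 1}

/-! ## Card `dilated-constants-single-box` — first lemma -/

/-- **MonomialDilatesConstant.** On the open unit box the monomial `q·(x₀x₁)ᵏ` and the CONSTANT
`q/(k+1)²` are ONE change-of-variables move apart: `Φ(x) = (x₀^{k+1}, x₁^{k+1})` maps the box onto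
itself with Jacobian `(k+1)²(x₀x₁)ᵏ`, so `q (x₀x₁)ᵏ = (q/(k+1)²)∘Φ · |det Φ'|`. Hence the polynomial
part of the partial-fraction expansion of `P(t)/(1 − t⁶)` is normalised WITHOUT rule 3). -/
def MonomialDilatesConstant : Prop :=
  ∀ (k : ℕ) (q : ℚ) (r r' : KZ.IntegralRep 2), r.domain = box → r'.domain = box →
    Set.EqOn r.integrand (fun x => (q : ℝ) * (x 0 * x 1) ^ k) r.domain →
    Set.EqOn r'.integrand (fun _ => (q : ℝ) / ((k : ℝ) + 1) ^ 2) r'.domain →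
    KZ.of r - KZ.of r' ∈ KZ.changeOfVariablesRel

/-- `MonomialDilatesConstant` is the instance `n = 2`, `m = k+1`, constant target integrand of the
route's engine `DilationMove` (stmt-KontsevichZagierPeriods-3872). -/
theorem monomialDilatesConstant_of_dilationMove (h : DilationMove) : MonomialDilatesConstant := by
  intro k q r r' hr hr' hf hf'
  refine h 2 (k + 1) (Nat.succ_pos k) r r' hr hr' ?_
  intro x hx
  have hxB : ∀ i, x i ∈ Set.Ioo (0:ℝ) 1 := by rw [hr] at hx; exact hx
  have hΦ : (fun i => x i ^ (k + 1)) ∈ r'.domain := by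
    rw [hr']
    intro i
    exact ⟨pow_pos (hxB i).1 _, pow_lt_one₀ (hxB i).1.le (hxB i).2 (Nat.succ_ne_zero k)⟩
  rw [hf hx, hf' hΦ]
  simp only [Nat.add_sub_cancel, Fin.prod_univ_two]
  have hk : ((k : ℝ) + 1) ≠ 0 := by positivity
  push_cast
  field_simp
  ring

/-! ## Card `hecke-kernel-certificate` — transfer C⁺ and first lemma -/

/-- The **dilation operator** on one-variable integrands, `(U m F)(t) = m² t^{m−1} F(tᵐ)`: the
integrand of `[B, F(x₀x₁)]` pulled back along `Φₘ(x) = (x₀ᵐ, x₁ᵐ)` with its Jacobian. On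
`t^a/(1 − t^N)` it is the Hurwitz distribution map `N ↦ Nm`; on constants, `U (k+1) c = (k+1)² c tᵏ`. -/
def U (m : ℕ) (F : ℝ → ℝ) : ℝ → ℝ := fun t => (m : ℝ) ^ 2 * t ^ (m - 1) * F (t ^ m)

/-- **DilationInvariant** (C⁺, analytic half): the box symbol is `U m`-invariant —
`[B, (U m F)(x₀x₁)] − [B, F(x₀x₁)]` is one change-of-variables move, for every `m ≥ 1` and every
`F` (admissibility = the two representations exist). -/
def DilationInvariant : Prop :=
  ∀ (m : ℕ), 1 ≤ m → ∀ (F : ℝ → ℝ) (r r' : KZ.IntegralRep 2), r.domain = box → r'.domain = box →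
    Set.EqOn r.integrand (fun x => U m F (x 0 * x 1)) r.domain →
    Set.EqOn r'.integrand (fun x => F (x 0 * x 1)) r'.domain →
    KZ.of r - KZ.of r' ∈ KZ.changeOfVariablesRel

/-- `DilationInvariant` is `DilationMove` (stmt-3872) read at `n = 2` on integrands that factor
through `t = x₀x₁`. -/
theorem dilationInvariant_of_dilationMove (h : DilationMove) : DilationInvariant := by
  intro m hm F r r' hr hr' hf hf'
  refine h 2 m hm r r' hr hr' ?_
  intro x hx
  have hxB : ∀ i, x i ∈ Set.Ioo (0:ℝ) 1 := by rw [hr] at hx; exact hx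
  have hΦ : (fun i => x i ^ m) ∈ r'.domain := by
    rw [hr']
    intro i
    exact ⟨pow_pos (hxB i).1 _, pow_lt_one₀ (hxB i).1.le (hxB i).2 (by omega)⟩
  rw [hf hx, hf' hΦ]
  simp only [U, Fin.prod_univ_two, mul_pow]
  ring

/-- **KernelGeneratorVanishes** (first lemma of card `hecke-kernel-certificate`): the `m = 2`
family of kernel generators, parametric in the level-3 numerator `A ∈ ℚ[t]` —
`[B, 4t·A(t²)/(1 − t⁶)] ∼ [B, A(t)/(1 − t³)]` (`t = x₀x₁`), i.e. `Λ_B((U₂ − 1)(A/(1−t³))) = 0`.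
With `A = 1, t, t²` these are the level-6 relations `H₀+H₃ ∼ 4H₁`, `H₁+H₄ ∼ 4H₃`, `H₂+H₅ ∼ 4H₅`;
with `A = 1 − t` it sends the normal-form integrand `1/(1+t+t²)` to `4(t − t³)/(1 − t⁶)`. -/
def KernelGeneratorVanishes : Prop :=
  ∀ (A : Polynomial ℚ) (r r' : KZ.IntegralRep 2), r.domain = box → r'.domain = box →
    Set.EqOn r.integrand
      (fun x => 4 * (x 0 * x 1) * Polynomial.aeval ((x 0 * x 1) ^ 2) A / (1 - (x 0 * x 1) ^ 6))
      r.domain →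
    Set.EqOn r'.integrand
      (fun x => Polynomial.aeval (x 0 * x 1) A / (1 - (x 0 * x 1) ^ 3)) r'.domain →
    KZ.Equivalent r r'

/-- The first lemma is the instance `m = 2`, `F = A/(1 − t³)` of `DilationInvariant`. -/
theorem kernelGeneratorVanishes_of_dilationInvariant (h : DilationInvariant) :
    KernelGeneratorVanishes := by
  intro A r r' hr hr' hf hf'
  have key := h 2 (by norm_num) (fun t => Polynomial.aeval t A / (1 - t ^ 3)) r r' hr hr' ?_ hf'
  · exact KZ.changeOfVariablesRel_subset_relations key
  · intro x hx
    rw [hf hx]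
    simp only [U]
    norm_num
    ring

/-- **KernelDecomposition** (C⁺, algebraic half; pure commutative algebra, no measure theory):
for every `P ∈ ℚ[t]` the difference between `P/(1 − t⁶)` and its normal form
`a + b/(1−t) + c/(1+t+t²)` is an explicit `ℚ`-combination of `(U m − 1)`-images:
`(U₂ − 1)(tⁱ/(1−t³))` (`i = 0,1,2`), `(U₆ − 1)(1/(1−t))`, `(U₂ − 1)(1/(1+t+t²))` and the monomial
defects `(U_{k+1} − 1)(1) = (k+1)²tᵏ − 1`. (The four non-monomial generators span the
4-dimensional kernel of the level-6 Hurwitz span: det = ±288 with the two normal-form vectors.) -/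
def KernelDecomposition : Prop :=
  ∀ P : Polynomial ℚ, ∃ (a b c A₀ A₁ A₂ β γ : ℚ) (μ : ℕ →₀ ℚ),
    ∀ t ∈ Set.Ioo (0:ℝ) 1,
      Polynomial.aeval t P / (1 - t ^ 6) - ((a : ℝ) + b / (1 - t) + c / (1 + t + t ^ 2)) =
        (A₀ : ℝ) * (4 * t / (1 - t ^ 6) - 1 / (1 - t ^ 3))
        + A₁ * (4 * t ^ 3 / (1 - t ^ 6) - t / (1 - t ^ 3))
        + A₂ * (4 * t ^ 5 / (1 - t ^ 6) - t ^ 2 / (1 - t ^ 3))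
        + β * (36 * t ^ 5 / (1 - t ^ 6) - 1 / (1 - t))
        + γ * (4 * (t - t ^ 3) / (1 - t ^ 6) - 1 / (1 + t + t ^ 2))
        + μ.sum (fun k q => (q : ℝ) * (((k : ℝ) + 1) ^ 2 * t ^ k - 1))

/-- **SectorRepExists** (the single representation constructor of the line): every
`P(x₀x₁)/(1 − (x₀x₁)^N)`, `N ≥ 1`, is the integrand of an integral representation on the open box
(semialgebraic: `isSemialgebraicFunOn_aeval_div_aeval`; integrable: dominated by `1/(1 − x₀x₁)`,
`BoxIntegral.integrableOn_box_pow_div_one_sub_pow`). -/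
def SectorRepExists : Prop :=
  ∀ (P : Polynomial ℚ) (N : ℕ), 1 ≤ N → ∃ r : KZ.IntegralRep 2, r.domain = box ∧
    Set.EqOn r.integrand
      (fun x => Polynomial.aeval (x 0 * x 1) P / (1 - (x 0 * x 1) ^ N)) r.domain

/-- **Transfer** of card `hecke-kernel-certificate`: the transferred form
`C⁺ = DilationInvariant ∧ KernelDecomposition` (plus the constructor) implies the crux, by finite
integrand additivity on the fixed box (`KZ.of_sub_sum_integrand_mem_relations`) — stated here,
to be proved by the line (it is the assembly, ≈ bookkeeping over a `Finsupp`). -/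
def Transfer : Prop :=
  DilationInvariant → KernelDecomposition → SectorRepExists → ReductionTwoSix


/-! ## Bonus: towards a kernel-checked `Transfer` (C⁺ ⇒ crux)

Elementary facts on the box, and the generic KERNEL LEMMA: a representation on the box whose
integrand is `(U m F − F)(x₀x₁)` is a relation, given `DilationInvariant` and the constructor. -/

section TransferProof

/-- On the box, `t = x₀x₁ ∈ (0,1)`. -/
theorem t_mem {x : Fin 2 → ℝ} (hx : x ∈ box) : x 0 * x 1 ∈ Set.Ioo (0:ℝ) 1 :=
  ⟨mul_pos (hx 0).1 (hx 1).1,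
    mul_lt_one_of_nonneg_of_lt_one_left (hx 0).1.le (hx 0).2 (hx 1).2.le⟩

/-- The denominators of the line never vanish on `(0,1)`. -/
theorem den_ne {t : ℝ} (ht : t ∈ Set.Ioo (0:ℝ) 1) :
    1 - t ≠ 0 ∧ 1 - t ^ 3 ≠ 0 ∧ 1 - t ^ 6 ≠ 0 ∧ 1 + t + t ^ 2 ≠ 0 ∧ 1 + t ^ 2 + t ^ 4 ≠ 0 := by
  obtain ⟨h0, h1⟩ := ht
  have h3 : t ^ 3 < 1 := pow_lt_one₀ h0.le h1 (by norm_num)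
  have h6 : t ^ 6 < 1 := pow_lt_one₀ h0.le h1 (by norm_num)
  refine ⟨by linarith, by linarith, by linarith, ?_, ?_⟩
  · positivity
  · positivity

/-- **Kernel lemma.** If `Kp`, `Km`, `K` are representations on the box with integrands
`U m F`, `F`, `U m F − F` (composed with `t = x₀x₁`), then `[K]` is a relation: one change of
variables (`DilationInvariant`) and two integrand additivities against a zero representation. -/
theorem kernel_mem (hDI : DilationInvariant) (hSR : SectorRepExists) {m : ℕ} (hm : 1 ≤ m)
    (F : ℝ → ℝ) (K Kp Km : KZ.IntegralRep 2) (hK : K.domain = box) (hKp : Kp.domain = box)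
    (hKm : Km.domain = box) (eKp : Set.EqOn Kp.integrand (fun x => U m F (x 0 * x 1)) box)
    (eKm : Set.EqOn Km.integrand (fun x => F (x 0 * x 1)) box)
    (eK : Set.EqOn K.integrand (fun x => U m F (x 0 * x 1) - F (x 0 * x 1)) box) :
    KZ.of K ∈ KZ.relations := by
  -- the dilation move
  have h1 : KZ.of Kp - KZ.of Km ∈ KZ.relations :=
    KZ.changeOfVariablesRel_subset_relations
      (hDI m hm F Kp Km hKp hKm (fun x hx => eKp (by rw [hKp] at hx; exact hx))
        (fun x hx => eKm (by rw [hKm] at hx; exact hx)))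
  -- a zero representation on the box
  obtain ⟨Z, hZ, eZ⟩ := hSR 0 6 (by norm_num)
  have eZ0 : Set.EqOn Z.integrand 0 Z.domain := fun x hx => by
    rw [eZ hx]; simp
  have hZ0 : KZ.of Z ∈ KZ.relations := KZ.of_mem_relations_of_eqOn_zero Z eZ0
  -- `[Z] − [Km] − [Km.neg]` and `[K] − [Kp] − [Km.neg]` are integrand additivities
  have h2 : KZ.of Z - KZ.of Km - KZ.of Km.neg ∈ KZ.relations := by
    refine KZ.integrandAddRel_subset_relations ⟨2, Z, Km, Km.neg, by rw [hKm, hZ], ?_, ?_, rfl⟩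
    · rw [KZ.IntegralRep.domain_neg, hKm, hZ]
    · intro x hx
      rw [eZ0 hx]
      simp
  have h3 : KZ.of K - KZ.of Kp - KZ.of Km.neg ∈ KZ.relations := by
    refine KZ.integrandAddRel_subset_relations ⟨2, K, Kp, Km.neg, by rw [hKp, hK], ?_, ?_, rfl⟩
    · rw [KZ.IntegralRep.domain_neg, hKm, hK]
    · intro x hx
      have hx' : x ∈ box := by rw [hK] at hx; exact hx
      simp only [Pi.add_apply, KZ.IntegralRep.integrand_neg, Pi.neg_apply]
      rw [eK hx', eKp hx', eKm hx']
      ring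
  have e : KZ.of K = (KZ.of K - KZ.of Kp - KZ.of Km.neg) + (KZ.of Kp - KZ.of Km)
      - (KZ.of Z - KZ.of Km - KZ.of Km.neg) + KZ.of Z := by abel
  rw [e]
  exact add_mem (sub_mem (add_mem h3 h1) h2) hZ0


/-! ### The explicit numerators of the line and their pointwise identities on `(0,1)` -/

open Polynomial

/-- normal-form numerator: `a(1−t⁶) + b(1+t+⋯+t⁵) + c(1−t+t³−t⁴)`. -/
def pNF (a b c : ℚ) : ℚ[X] :=
  C a * (1 - X ^ 6) + C b * (1 + X + X ^ 2 + X ^ 3 + X ^ 4 + X ^ 5) + C c * (1 - X + X ^ 3 - X ^ 4)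

/-- level-3 numerator `A = A₀ + A₁t + A₂t²` (the `U₂`-preimage is `A/(1−t³)`). -/
def pA (A₀ A₁ A₂ : ℚ) : ℚ[X] := C A₀ + C A₁ * X + C A₂ * X ^ 2

/-- numerator of `U₂(A/(1−t³)) = 4t·A(t²)/(1−t⁶)`. -/
def pAp (A₀ A₁ A₂ : ℚ) : ℚ[X] := C 4 * X * (C A₀ + C A₁ * X ^ 2 + C A₂ * X ^ 4)

/-- numerator of the kernel element `(U₂ − 1)(A/(1−t³))` over `1 − t⁶`. -/
def pAk (A₀ A₁ A₂ : ℚ) : ℚ[X] :=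
  C A₀ * (C 4 * X - 1 - X ^ 3) + C A₁ * (C 4 * X ^ 3 - X - X ^ 4) + C A₂ * (C 3 * X ^ 5 - X ^ 2)

/-- numerator of `U₆(β/(1−t)) = 36β t⁵/(1−t⁶)`. -/
def pBp (β : ℚ) : ℚ[X] := C (36 * β) * X ^ 5

/-- numerator of the kernel element `(U₆ − 1)(β/(1−t))` over `1 − t⁶`. -/
def pBk (β : ℚ) : ℚ[X] := C β * (C 36 * X ^ 5 - (1 + X + X ^ 2 + X ^ 3 + X ^ 4 + X ^ 5))

/-- numerator of `U₂(γ/(1+t+t²)) = 4γ(t − t³)/(1−t⁶)`. -/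
def pGp (γ : ℚ) : ℚ[X] := C (4 * γ) * (X - X ^ 3)

/-- numerator of `γ/(1+t+t²) = γ(1−t)/(1−t³)` over `1 − t³`. -/
def pGm (γ : ℚ) : ℚ[X] := C γ * (1 - X)

/-- numerator of the kernel element `(U₂ − 1)(γ/(1+t+t²))` over `1 − t⁶`. -/
def pGk (γ : ℚ) : ℚ[X] := C γ * (C 4 * (X - X ^ 3) - (1 - X + X ^ 3 - X ^ 4))

/-- numerator of the monomial `U_{k+1}(q) = (k+1)²q tᵏ` over `1 − t⁶`. -/
def pMp (k : ℕ) (q : ℚ) : ℚ[X] := C (((k:ℚ) + 1) ^ 2 * q) * X ^ k * (1 - X ^ 6)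

/-- numerator of the constant `q` over `1 − t⁶`. -/
def pMm (q : ℚ) : ℚ[X] := C q * (1 - X ^ 6)

/-- numerator of the monomial defect `q((k+1)²tᵏ − 1)` over `1 − t⁶`. -/
def pMk (k : ℕ) (q : ℚ) : ℚ[X] := C q * (C (((k:ℚ) + 1) ^ 2) * X ^ k - 1) * (1 - X ^ 6)

section Pointwise

variable {t : ℝ}

theorem aeval_pNF (a b c : ℚ) (ht : t ∈ Set.Ioo (0:ℝ) 1) :
    Polynomial.aeval t (pNF a b c) / (1 - t ^ 6) = (a : ℝ) + b / (1 - t) + c / (1 + t + t ^ 2) := by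
  obtain ⟨h1, h3, h6, hc, hq⟩ := den_ne ht
  simp only [pNF, map_add, map_sub, map_mul, map_pow, map_one, Polynomial.aeval_C,
    Polynomial.aeval_X, eq_ratCast]
  field_simp
  ring

theorem aeval_pAp (A₀ A₁ A₂ : ℚ) (ht : t ∈ Set.Ioo (0:ℝ) 1) :
    Polynomial.aeval t (pAp A₀ A₁ A₂) / (1 - t ^ 6)
      = U 2 (fun s => Polynomial.aeval s (pA A₀ A₁ A₂) / (1 - s ^ 3)) t := by
  obtain ⟨h1, h3, h6, hc, hq⟩ := den_ne ht
  have h6' : 1 - (t ^ 2) ^ 3 ≠ 0 := by rw [← pow_mul]; exact h6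
  simp only [pAp, pA, U, map_add, map_sub, map_mul, map_pow, map_one, Polynomial.aeval_C,
    Polynomial.aeval_X, eq_ratCast, Rat.cast_ofNat, Nat.cast_ofNat]
  norm_num
  field_simp

theorem aeval_pAk (A₀ A₁ A₂ : ℚ) (ht : t ∈ Set.Ioo (0:ℝ) 1) :
    Polynomial.aeval t (pAk A₀ A₁ A₂) / (1 - t ^ 6)
      = U 2 (fun s => Polynomial.aeval s (pA A₀ A₁ A₂) / (1 - s ^ 3)) t
        - (fun s => Polynomial.aeval s (pA A₀ A₁ A₂) / (1 - s ^ 3)) t := by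
  obtain ⟨h1, h3, h6, hc, hq⟩ := den_ne ht
  have h6' : 1 - (t ^ 2) ^ 3 ≠ 0 := by rw [← pow_mul]; exact h6
  simp only [pAk, pA, U, map_add, map_sub, map_mul, map_pow, map_one, Polynomial.aeval_C,
    Polynomial.aeval_X, eq_ratCast, Rat.cast_ofNat, Nat.cast_ofNat]
  norm_num
  field_simp
  ring

theorem aeval_pAk' (A₀ A₁ A₂ : ℚ) (ht : t ∈ Set.Ioo (0:ℝ) 1) :
    Polynomial.aeval t (pAk A₀ A₁ A₂) / (1 - t ^ 6)
      = (A₀ : ℝ) * (4 * t / (1 - t ^ 6) - 1 / (1 - t ^ 3))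
        + A₁ * (4 * t ^ 3 / (1 - t ^ 6) - t / (1 - t ^ 3))
        + A₂ * (4 * t ^ 5 / (1 - t ^ 6) - t ^ 2 / (1 - t ^ 3)) := by
  obtain ⟨h1, h3, h6, hc, hq⟩ := den_ne ht
  simp only [pAk, map_add, map_sub, map_mul, map_pow, map_one, Polynomial.aeval_C,
    Polynomial.aeval_X, eq_ratCast, Rat.cast_ofNat]
  field_simp
  ring

theorem aeval_pBp (β : ℚ) (ht : t ∈ Set.Ioo (0:ℝ) 1) :
    Polynomial.aeval t (pBp β) / (1 - t ^ 6) = U 6 (fun s => (β : ℝ) / (1 - s)) t := by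
  obtain ⟨h1, h3, h6, hc, hq⟩ := den_ne ht
  simp only [pBp, U, map_mul, map_pow, Polynomial.aeval_C, Polynomial.aeval_X, eq_ratCast,
    Rat.cast_mul, Rat.cast_ofNat, Nat.cast_ofNat]
  norm_num
  ring

theorem aeval_pBm (β : ℚ) (ht : t ∈ Set.Ioo (0:ℝ) 1) :
    Polynomial.aeval t (C β) / (1 - t ^ 1) = (fun s => (β : ℝ) / (1 - s)) t := by
  simp only [Polynomial.aeval_C, eq_ratCast, pow_one]

theorem aeval_pBk (β : ℚ) (ht : t ∈ Set.Ioo (0:ℝ) 1) :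
    Polynomial.aeval t (pBk β) / (1 - t ^ 6)
      = U 6 (fun s => (β : ℝ) / (1 - s)) t - (fun s => (β : ℝ) / (1 - s)) t := by
  obtain ⟨h1, h3, h6, hc, hq⟩ := den_ne ht
  simp only [pBk, U, map_add, map_sub, map_mul, map_pow, map_one, Polynomial.aeval_C,
    Polynomial.aeval_X, eq_ratCast, Rat.cast_ofNat, Nat.cast_ofNat]
  norm_num
  field_simp
  ring

theorem aeval_pBk' (β : ℚ) (ht : t ∈ Set.Ioo (0:ℝ) 1) :
    Polynomial.aeval t (pBk β) / (1 - t ^ 6)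
      = (β : ℝ) * (36 * t ^ 5 / (1 - t ^ 6) - 1 / (1 - t)) := by
  obtain ⟨h1, h3, h6, hc, hq⟩ := den_ne ht
  simp only [pBk, map_add, map_sub, map_mul, map_pow, map_one, Polynomial.aeval_C,
    Polynomial.aeval_X, eq_ratCast, Rat.cast_ofNat]
  field_simp
  ring

theorem aeval_pGp (γ : ℚ) (ht : t ∈ Set.Ioo (0:ℝ) 1) :
    Polynomial.aeval t (pGp γ) / (1 - t ^ 6) = U 2 (fun s => (γ : ℝ) / (1 + s + s ^ 2)) t := by
  obtain ⟨h1, h3, h6, hc, hq⟩ := den_ne ht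
  have hq' : 1 + t ^ 2 + (t ^ 2) ^ 2 ≠ 0 := by positivity
  simp only [pGp, U, map_sub, map_mul, map_pow, Polynomial.aeval_C, Polynomial.aeval_X,
    eq_ratCast, Rat.cast_mul, Rat.cast_ofNat, Nat.cast_ofNat]
  norm_num
  field_simp
  ring

theorem aeval_pGm (γ : ℚ) (ht : t ∈ Set.Ioo (0:ℝ) 1) :
    Polynomial.aeval t (pGm γ) / (1 - t ^ 3) = (fun s => (γ : ℝ) / (1 + s + s ^ 2)) t := by
  obtain ⟨h1, h3, h6, hc, hq⟩ := den_ne ht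
  simp only [pGm, map_sub, map_mul, map_one, Polynomial.aeval_C, Polynomial.aeval_X, eq_ratCast]
  field_simp
  ring

theorem aeval_pGk (γ : ℚ) (ht : t ∈ Set.Ioo (0:ℝ) 1) :
    Polynomial.aeval t (pGk γ) / (1 - t ^ 6)
      = U 2 (fun s => (γ : ℝ) / (1 + s + s ^ 2)) t - (fun s => (γ : ℝ) / (1 + s + s ^ 2)) t := by
  obtain ⟨h1, h3, h6, hc, hq⟩ := den_ne ht
  have hq' : 1 + t ^ 2 + (t ^ 2) ^ 2 ≠ 0 := by positivity
  simp only [pGk, U, map_add, map_sub, map_mul, map_pow, map_one, Polynomial.aeval_C,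
    Polynomial.aeval_X, eq_ratCast, Rat.cast_ofNat, Nat.cast_ofNat]
  norm_num
  field_simp
  ring

theorem aeval_pGk' (γ : ℚ) (ht : t ∈ Set.Ioo (0:ℝ) 1) :
    Polynomial.aeval t (pGk γ) / (1 - t ^ 6)
      = (γ : ℝ) * (4 * (t - t ^ 3) / (1 - t ^ 6) - 1 / (1 + t + t ^ 2)) := by
  obtain ⟨h1, h3, h6, hc, hq⟩ := den_ne ht
  simp only [pGk, map_add, map_sub, map_mul, map_pow, map_one, Polynomial.aeval_C,
    Polynomial.aeval_X, eq_ratCast, Rat.cast_ofNat]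
  field_simp
  ring

theorem aeval_pMp (k : ℕ) (q : ℚ) (ht : t ∈ Set.Ioo (0:ℝ) 1) :
    Polynomial.aeval t (pMp k q) / (1 - t ^ 6) = U (k + 1) (fun _ => (q : ℝ)) t := by
  obtain ⟨h1, h3, h6, hc, hq⟩ := den_ne ht
  simp only [pMp, U, map_sub, map_mul, map_pow, map_one, Polynomial.aeval_C, Polynomial.aeval_X,
    eq_ratCast, Rat.cast_mul, Rat.cast_pow, Rat.cast_add, Rat.cast_natCast, Rat.cast_one,
    Nat.add_sub_cancel]
  push_cast
  field_simp

theorem aeval_pMm (q : ℚ) (ht : t ∈ Set.Ioo (0:ℝ) 1) :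
    Polynomial.aeval t (pMm q) / (1 - t ^ 6) = (fun _ => (q : ℝ)) t := by
  obtain ⟨h1, h3, h6, hc, hq⟩ := den_ne ht
  simp only [pMm, map_sub, map_mul, map_pow, map_one, Polynomial.aeval_C, Polynomial.aeval_X,
    eq_ratCast]
  field_simp

theorem aeval_pMk (k : ℕ) (q : ℚ) (ht : t ∈ Set.Ioo (0:ℝ) 1) :
    Polynomial.aeval t (pMk k q) / (1 - t ^ 6)
      = U (k + 1) (fun _ => (q : ℝ)) t - (fun _ => (q : ℝ)) t := by
  obtain ⟨h1, h3, h6, hc, hq⟩ := den_ne ht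
  simp only [pMk, U, map_sub, map_mul, map_pow, map_one, Polynomial.aeval_C, Polynomial.aeval_X,
    eq_ratCast, Rat.cast_mul, Rat.cast_pow, Rat.cast_add, Rat.cast_natCast, Rat.cast_one,
    Nat.add_sub_cancel]
  push_cast
  field_simp

theorem aeval_pMk' (k : ℕ) (q : ℚ) (ht : t ∈ Set.Ioo (0:ℝ) 1) :
    Polynomial.aeval t (pMk k q) / (1 - t ^ 6) = (q : ℝ) * (((k : ℝ) + 1) ^ 2 * t ^ k - 1) := by
  obtain ⟨h1, h3, h6, hc, hq⟩ := den_ne ht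
  simp only [pMk, map_sub, map_mul, map_pow, map_one, Polynomial.aeval_C, Polynomial.aeval_X,
    eq_ratCast, Rat.cast_mul, Rat.cast_pow, Rat.cast_add, Rat.cast_natCast, Rat.cast_one]
  field_simp

end Pointwise


/-! ### The assembly: `C⁺ ⇒ crux`, kernel-checked -/

/-- Convenience: `EqOn` on `box` from the constructor's `EqOn` on `r.domain = box`. -/
theorem eqOn_of_rep {r : KZ.IntegralRep 2} {f g : (Fin 2 → ℝ) → ℝ} (hr : r.domain = box)
    (h : Set.EqOn r.integrand f r.domain) (hfg : ∀ x ∈ box, f x = g x) :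
    Set.EqOn r.integrand g box := fun x hx =>
  (h (show x ∈ r.domain by rw [hr]; exact hx)).trans (hfg x hx)

/-- **Transfer holds**: `DilationInvariant → KernelDecomposition → SectorRepExists →
ReductionTwoSix`. The proof is the finite rule-1b) bookkeeping over the certificate: the given
representation minus the normal form minus the kernel representations is one iterated integrand
additivity (`KZ.of_sub_sum_integrand_mem_relations`), and each kernel representation is a relation
by `kernel_mem`. No Newton–Leibniz, no domain additivity, no change of dimension. -/
theorem transfer_holds : Transfer := by
  intro hDI hKD hSR r P hr hf
  obtain ⟨a, b, c, A₀, A₁, A₂, β, γ, μ, hdec⟩ := hKD P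
  -- the normal form
  obtain ⟨rNF, hNF, eNF0⟩ := hSR (pNF a b c) 6 (by norm_num)
  have eNF : Set.EqOn rNF.integrand
      (fun x => (a : ℝ) + b / (1 - x 0 * x 1) + c / (1 + x 0 * x 1 + (x 0 * x 1) ^ 2)) box :=
    eqOn_of_rep hNF eNF0 fun x hx => aeval_pNF a b c (t_mem hx)
  refine ⟨a, b, c, rNF, hNF, fun x hx => eNF (by rw [hNF] at hx; exact hx), ?_⟩
  -- kernel representation for the `A`-part (m = 2 on `A/(1−t³)`)
  obtain ⟨KA, hKA, eKA0⟩ := hSR (pAk A₀ A₁ A₂) 6 (by norm_num)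
  obtain ⟨KAp, hKAp, eKAp0⟩ := hSR (pAp A₀ A₁ A₂) 6 (by norm_num)
  obtain ⟨KAm, hKAm, eKAm0⟩ := hSR (pA A₀ A₁ A₂) 3 (by norm_num)
  have mA : KZ.of KA ∈ KZ.relations :=
    kernel_mem hDI hSR (m := 2) (by norm_num)
      (fun s => Polynomial.aeval s (pA A₀ A₁ A₂) / (1 - s ^ 3)) KA KAp KAm hKA hKAp hKAm
      (eqOn_of_rep hKAp eKAp0 fun x hx => aeval_pAp A₀ A₁ A₂ (t_mem hx))
      (eqOn_of_rep hKAm eKAm0 fun x _ => rfl)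
      (eqOn_of_rep hKA eKA0 fun x hx => aeval_pAk A₀ A₁ A₂ (t_mem hx))
  have eKA : Set.EqOn KA.integrand (fun x =>
      (A₀ : ℝ) * (4 * (x 0 * x 1) / (1 - (x 0 * x 1) ^ 6) - 1 / (1 - (x 0 * x 1) ^ 3))
        + A₁ * (4 * (x 0 * x 1) ^ 3 / (1 - (x 0 * x 1) ^ 6) - (x 0 * x 1) / (1 - (x 0 * x 1) ^ 3))
        + A₂ * (4 * (x 0 * x 1) ^ 5 / (1 - (x 0 * x 1) ^ 6)
            - (x 0 * x 1) ^ 2 / (1 - (x 0 * x 1) ^ 3))) box :=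
    eqOn_of_rep hKA eKA0 fun x hx => aeval_pAk' A₀ A₁ A₂ (t_mem hx)
  -- kernel representation for the `β`-part (m = 6 on `β/(1−t)`)
  obtain ⟨KB, hKB, eKB0⟩ := hSR (pBk β) 6 (by norm_num)
  obtain ⟨KBp, hKBp, eKBp0⟩ := hSR (pBp β) 6 (by norm_num)
  obtain ⟨KBm, hKBm, eKBm0⟩ := hSR (C β) 1 (by norm_num)
  have mB : KZ.of KB ∈ KZ.relations :=
    kernel_mem hDI hSR (m := 6) (by norm_num) (fun s => (β : ℝ) / (1 - s)) KB KBp KBm hKB hKBp hKBm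
      (eqOn_of_rep hKBp eKBp0 fun x hx => aeval_pBp β (t_mem hx))
      (eqOn_of_rep hKBm eKBm0 fun x hx => aeval_pBm β (t_mem hx))
      (eqOn_of_rep hKB eKB0 fun x hx => aeval_pBk β (t_mem hx))
  have eKB : Set.EqOn KB.integrand
      (fun x => (β : ℝ) * (36 * (x 0 * x 1) ^ 5 / (1 - (x 0 * x 1) ^ 6) - 1 / (1 - x 0 * x 1)))
      box :=
    eqOn_of_rep hKB eKB0 fun x hx => aeval_pBk' β (t_mem hx)
  -- kernel representation for the `γ`-part (m = 2 on `γ/(1+t+t²)`)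
  obtain ⟨KG, hKG, eKG0⟩ := hSR (pGk γ) 6 (by norm_num)
  obtain ⟨KGp, hKGp, eKGp0⟩ := hSR (pGp γ) 6 (by norm_num)
  obtain ⟨KGm, hKGm, eKGm0⟩ := hSR (pGm γ) 3 (by norm_num)
  have mG : KZ.of KG ∈ KZ.relations :=
    kernel_mem hDI hSR (m := 2) (by norm_num) (fun s => (γ : ℝ) / (1 + s + s ^ 2)) KG KGp KGm
      hKG hKGp hKGm
      (eqOn_of_rep hKGp eKGp0 fun x hx => aeval_pGp γ (t_mem hx))
      (eqOn_of_rep hKGm eKGm0 fun x hx => aeval_pGm γ (t_mem hx))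
      (eqOn_of_rep hKG eKG0 fun x hx => aeval_pGk γ (t_mem hx))
  have eKG : Set.EqOn KG.integrand (fun x => (γ : ℝ) *
      (4 * (x 0 * x 1 - (x 0 * x 1) ^ 3) / (1 - (x 0 * x 1) ^ 6)
        - 1 / (1 + x 0 * x 1 + (x 0 * x 1) ^ 2))) box :=
    eqOn_of_rep hKG eKG0 fun x hx => aeval_pGk' γ (t_mem hx)
  -- kernel representations for the monomial defects (m = k+1 on the constant `μ k`)
  have hMk : ∀ k : ℕ, ∃ K : KZ.IntegralRep 2, K.domain = box ∧
      Set.EqOn K.integrand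
        (fun x => (μ k : ℝ) * (((k : ℝ) + 1) ^ 2 * (x 0 * x 1) ^ k - 1)) box ∧
      KZ.of K ∈ KZ.relations := by
    intro k
    obtain ⟨K, hK, eK0⟩ := hSR (pMk k (μ k)) 6 (by norm_num)
    obtain ⟨Kp, hKp, eKp0⟩ := hSR (pMp k (μ k)) 6 (by norm_num)
    obtain ⟨Km, hKm, eKm0⟩ := hSR (pMm (μ k)) 6 (by norm_num)
    refine ⟨K, hK, eqOn_of_rep hK eK0 fun x hx => aeval_pMk' k (μ k) (t_mem hx), ?_⟩
    exact kernel_mem hDI hSR (m := k + 1) (Nat.succ_pos k) (fun _ => (μ k : ℝ)) K Kp Km hK hKp hKm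
      (eqOn_of_rep hKp eKp0 fun x hx => aeval_pMp k (μ k) (t_mem hx))
      (eqOn_of_rep hKm eKm0 fun x hx => aeval_pMm (μ k) (t_mem hx))
      (eqOn_of_rep hK eK0 fun x hx => aeval_pMk k (μ k) (t_mem hx))
  choose KM hKM eKM mKM using hMk
  -- the finite family and the iterated integrand additivity
  let R : Fin 4 ⊕ ℕ → KZ.IntegralRep 2 := Sum.elim ![rNF, KA, KB, KG] KM
  have hsum : KZ.of r - ∑ i ∈ (Finset.univ : Finset (Fin 4)).disjSum μ.support, KZ.of (R i)
      ∈ KZ.relations := by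
    refine KZ.of_sub_sum_integrand_mem_relations _ R r ?_ ?_
    · rintro (j | k) -
      · fin_cases j
        · show rNF.domain = r.domain
          rw [hNF, hr]
        · show KA.domain = r.domain
          rw [hKA, hr]
        · show KB.domain = r.domain
          rw [hKB, hr]
        · show KG.domain = r.domain
          rw [hKG, hr]
      · show (KM k).domain = r.domain
        rw [hKM, hr]
    · intro x hx
      have hxB : x ∈ box := by rw [hr] at hx; exact hx
      have key := hdec (x 0 * x 1) (t_mem hxB)
      simp only [Finsupp.sum] at key
      show r.integrand x
        = ∑ i ∈ (Finset.univ : Finset (Fin 4)).disjSum μ.support, (R i).integrand x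
      rw [Finset.sum_disjSum, Fin.sum_univ_four]
      simp only [R, Sum.elim_inl, Sum.elim_inr, Matrix.cons_val_zero, Matrix.cons_val_one,
        Matrix.cons_val_two, Matrix.cons_val_three, Matrix.head_cons, Matrix.tail_cons]
      rw [hf hx, eNF hxB, eKA hxB, eKB hxB, eKG hxB,
        Finset.sum_congr rfl fun k _ => eKM k hxB]
      linarith
  have hrest : ∑ i ∈ (Finset.univ : Finset (Fin 4)).disjSum μ.support, KZ.of (R i) - KZ.of rNF
      ∈ KZ.relations := by
    rw [Finset.sum_disjSum, Fin.sum_univ_four]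
    simp only [R, Sum.elim_inl, Sum.elim_inr, Matrix.cons_val_zero, Matrix.cons_val_one,
      Matrix.cons_val_two, Matrix.cons_val_three, Matrix.head_cons, Matrix.tail_cons]
    have hS : ∑ k ∈ μ.support, KZ.of (KM k) ∈ KZ.relations := sum_mem fun k _ => mKM k
    have e : KZ.of rNF + KZ.of KA + KZ.of KB + KZ.of KG + ∑ k ∈ μ.support, KZ.of (KM k)
        - KZ.of rNF = KZ.of KA + KZ.of KB + KZ.of KG + ∑ k ∈ μ.support, KZ.of (KM k) := by abel
    rw [e]
    exact add_mem (add_mem (add_mem mA mB) mG) hS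
  show KZ.of r - KZ.of rNF ∈ KZ.relations
  have e2 : KZ.of r - KZ.of rNF
      = (KZ.of r - ∑ i ∈ (Finset.univ : Finset (Fin 4)).disjSum μ.support, KZ.of (R i))
        + (∑ i ∈ (Finset.univ : Finset (Fin 4)).disjSum μ.support, KZ.of (R i) - KZ.of rNF) := by
    abel
  rw [e2]
  exact add_mem hsum hrest


/-! ### The constructor holds: `SectorRepExists` (semialgebraic by `aeval_div_aeval`,
integrable as a finite sum of Hurwitz box integrands) -/

theorem sectorRepExists_holds : SectorRepExists := by
  intro P N hN
  have hbox : Literature.ModelTheory.ExponentialFields.IsSemialgebraic ℚ box :=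
    KZ.isSemialgebraic_box 2
  -- semialgebraicity of the integrand
  have hnum : ∀ x : Fin 2 → ℝ,
      MvPolynomial.aeval x (Polynomial.aeval (MvPolynomial.X 0 * MvPolynomial.X 1 :
        MvPolynomial (Fin 2) ℚ) P) = Polynomial.aeval (x 0 * x 1) P := by
    intro x
    rw [← Polynomial.aeval_algHom_apply]
    simp
  have hden : ∀ x : Fin 2 → ℝ, MvPolynomial.aeval x
      (1 - (MvPolynomial.X 0 * MvPolynomial.X 1) ^ N : MvPolynomial (Fin 2) ℚ)
        = 1 - (x 0 * x 1) ^ N := by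
    intro x
    simp
  have hden0 : ∀ x ∈ box, MvPolynomial.aeval x
      (1 - (MvPolynomial.X 0 * MvPolynomial.X 1) ^ N : MvPolynomial (Fin 2) ℚ) ≠ 0 := by
    intro x hx
    rw [hden]
    have ht := t_mem hx
    have : (x 0 * x 1) ^ N < 1 := pow_lt_one₀ ht.1.le ht.2 (by omega)
    linarith
  have hsa : IsSemialgebraicFunOn ℚ box
      (fun x : Fin 2 → ℝ => Polynomial.aeval (x 0 * x 1) P / (1 - (x 0 * x 1) ^ N)) :=
    (isSemialgebraicFunOn_aeval_div_aeval hbox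
        (Polynomial.aeval (MvPolynomial.X 0 * MvPolynomial.X 1 : MvPolynomial (Fin 2) ℚ) P)
        (1 - (MvPolynomial.X 0 * MvPolynomial.X 1) ^ N) hden0).congr
      (fun x _ => by beta_reduce; rw [hnum, hden])
  -- integrability: a finite sum of `coeff i · tⁱ/(1 − t^N)`
  have e : (fun x : Fin 2 → ℝ => Polynomial.aeval (x 0 * x 1) P / (1 - (x 0 * x 1) ^ N))
      = fun x => ∑ i ∈ Finset.range (P.natDegree + 1),
          (P.coeff i : ℝ) * ((x 0 * x 1) ^ i / (1 - (x 0 * x 1) ^ N)) := by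
    funext x
    rw [Polynomial.aeval_eq_sum_range, Finset.sum_div]
    refine Finset.sum_congr rfl fun i _ => ?_
    rw [Algebra.smul_def, eq_ratCast]
    ring
  have hint : IntegrableOn
      (fun x : Fin 2 → ℝ => Polynomial.aeval (x 0 * x 1) P / (1 - (x 0 * x 1) ^ N)) box := by
    rw [e]
    refine MeasureTheory.integrable_finsetSum _ fun i _ => ?_
    exact (BoxIntegral.integrableOn_box_pow_div_one_sub_pow hN i).const_mul _
  exact ⟨⟨box, _, hbox, hsa, hint⟩, rfl, fun _ _ => rfl⟩

/-- **Corollary.** The crux `ReductionTwoSix` follows from the route's engine `DilationMove`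
(stmt-3872) and the purely algebraic certificate `KernelDecomposition` alone. -/
theorem reductionTwoSix_of (hD : DilationMove) (hK : KernelDecomposition) : ReductionTwoSix :=
  transfer_holds (dilationInvariant_of_dilationMove hD) hK sectorRepExists_holds


/-! ### The certificate exists: `KernelDecomposition` holds (pure algebra in `ℚ[t]`)

Strategy: the predicate `KD P` ("`P` has a certificate") is additive and homogeneous in `P`, holds
for `Xʳ`, `r < 6`, by the inverse table of the basis `{k₁,k₂,k₃,k₆,n₁,n₂}` (six `field_simp; ring`
identities), and passes from `Xⁿ` to `Xⁿ⁺⁶` by the hexagonal shift `tⁿ⁺⁶/(1−t⁶) = tⁿ/(1−t⁶) − tⁿ`,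
the monomial `tⁿ` being absorbed by the defect row `(n+1)²tⁿ − 1` and the constant `a`. -/

/-- The kernel side of the certificate as a function of its data. -/
def kside (A₀ A₁ A₂ β γ : ℚ) (μ : ℕ →₀ ℚ) (t : ℝ) : ℝ :=
  (A₀ : ℝ) * (4 * t / (1 - t ^ 6) - 1 / (1 - t ^ 3))
    + A₁ * (4 * t ^ 3 / (1 - t ^ 6) - t / (1 - t ^ 3))
    + A₂ * (4 * t ^ 5 / (1 - t ^ 6) - t ^ 2 / (1 - t ^ 3))
    + β * (36 * t ^ 5 / (1 - t ^ 6) - 1 / (1 - t))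
    + γ * (4 * (t - t ^ 3) / (1 - t ^ 6) - 1 / (1 + t + t ^ 2))
    + μ.sum (fun k q => (q : ℝ) * (((k : ℝ) + 1) ^ 2 * t ^ k - 1))

/-- "`P` has a certificate". -/
def KD (P : ℚ[X]) : Prop :=
  ∃ (a b c A₀ A₁ A₂ β γ : ℚ) (μ : ℕ →₀ ℚ), ∀ t ∈ Set.Ioo (0:ℝ) 1,
    Polynomial.aeval t P / (1 - t ^ 6) - ((a : ℝ) + b / (1 - t) + c / (1 + t + t ^ 2))
      = kside A₀ A₁ A₂ β γ μ t

theorem kside_add (A₀ A₁ A₂ β γ A₀' A₁' A₂' β' γ' : ℚ) (μ μ' : ℕ →₀ ℚ) (t : ℝ) :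
    kside (A₀ + A₀') (A₁ + A₁') (A₂ + A₂') (β + β') (γ + γ') (μ + μ') t
      = kside A₀ A₁ A₂ β γ μ t + kside A₀' A₁' A₂' β' γ' μ' t := by
  simp only [kside]
  rw [Finsupp.sum_add_index' (fun k => by simp) (fun k q q' => by push_cast; ring)]
  push_cast
  ring

theorem sum_smul_aux (q : ℚ) (μ : ℕ →₀ ℚ) (t : ℝ) :
    (q • μ).sum (fun k a => (a : ℝ) * (((k : ℝ) + 1) ^ 2 * t ^ k - 1))
      = (q : ℝ) * μ.sum (fun k a => (a : ℝ) * (((k : ℝ) + 1) ^ 2 * t ^ k - 1)) := by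
  rw [Finsupp.sum_smul_index' (fun k => by simp)]
  simp only [Finsupp.sum, Finset.mul_sum, smul_eq_mul, Rat.cast_mul]
  refine Finset.sum_congr rfl fun k _ => ?_
  ring

theorem kside_smul (q A₀ A₁ A₂ β γ : ℚ) (μ : ℕ →₀ ℚ) (t : ℝ) :
    kside (q * A₀) (q * A₁) (q * A₂) (q * β) (q * γ) (q • μ) t
      = (q : ℝ) * kside A₀ A₁ A₂ β γ μ t := by
  simp only [kside]
  rw [sum_smul_aux]
  push_cast
  ring

theorem kside_add_single (A₀ A₁ A₂ β γ : ℚ) (μ : ℕ →₀ ℚ) (n : ℕ) (q : ℚ) (t : ℝ) :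
    kside A₀ A₁ A₂ β γ (μ + Finsupp.single n q) t
      = kside A₀ A₁ A₂ β γ μ t + (q : ℝ) * (((n : ℝ) + 1) ^ 2 * t ^ n - 1) := by
  simp only [kside]
  rw [Finsupp.sum_add_index' (fun k => by simp) (fun k q q' => by push_cast; ring),
    Finsupp.sum_single_index (by simp)]
  ring

theorem kd_zero : KD 0 :=
  ⟨0, 0, 0, 0, 0, 0, 0, 0, 0, fun t _ => by simp [kside]⟩

theorem kd_add {P Q : ℚ[X]} (hP : KD P) (hQ : KD Q) : KD (P + Q) := by
  obtain ⟨a, b, c, A₀, A₁, A₂, β, γ, μ, h⟩ := hP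
  obtain ⟨a', b', c', A₀', A₁', A₂', β', γ', μ', h'⟩ := hQ
  refine ⟨a + a', b + b', c + c', A₀ + A₀', A₁ + A₁', A₂ + A₂', β + β', γ + γ', μ + μ', ?_⟩
  intro t ht
  rw [kside_add, ← h t ht, ← h' t ht, map_add]
  push_cast
  ring

theorem kd_smul (q : ℚ) {P : ℚ[X]} (hP : KD P) : KD (C q * P) := by
  obtain ⟨a, b, c, A₀, A₁, A₂, β, γ, μ, h⟩ := hP
  refine ⟨q * a, q * b, q * c, q * A₀, q * A₁, q * A₂, q * β, q * γ, q • μ, ?_⟩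
  intro t ht
  rw [kside_smul, ← h t ht, map_mul, Polynomial.aeval_C, eq_ratCast]
  push_cast
  ring

/-- The hexagonal shift: a certificate for `Xⁿ` gives one for `Xⁿ⁺⁶`. -/
theorem kd_X_pow_step {n : ℕ} (h : KD (X ^ n)) : KD (X ^ (n + 6)) := by
  obtain ⟨a, b, c, A₀, A₁, A₂, β, γ, μ, h⟩ := h
  refine ⟨a - 1 / ((n : ℚ) + 1) ^ 2, b, c, A₀, A₁, A₂, β, γ,
    μ + Finsupp.single n (-(1 / ((n : ℚ) + 1) ^ 2)), ?_⟩
  intro t ht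
  obtain ⟨h1, h3, h6, hc, hq⟩ := den_ne ht
  rw [kside_add_single, ← h t ht]
  simp only [map_pow, Polynomial.aeval_X]
  have hn : ((n : ℝ) + 1) ≠ 0 := by positivity
  push_cast
  rw [pow_add]
  field_simp
  ring

/-- The six base rows (inverse table of `{k₁,k₂,k₃,k₆,n₁,n₂}`, determinant 1152). -/
theorem kd_X_pow_lt_six {r : ℕ} (hr : r < 6) : KD (X ^ r) := by
  interval_cases r
  · refine ⟨0, 1/3, 5/8, 0, -1/4, 3/8, -1/24, 0, 0, fun t ht => ?_⟩
    obtain ⟨h1, h3, h6, hc, hq⟩ := den_ne ht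
    simp only [kside, Finsupp.sum_zero_index, map_pow, Polynomial.aeval_X]
    push_cast
    field_simp
    ring
  · refine ⟨0, 1/9, 1/8, 1/4, 0, 1/8, -1/72, 0, 0, fun t ht => ?_⟩
    obtain ⟨h1, h3, h6, hc, hq⟩ := den_ne ht
    simp only [kside, Finsupp.sum_zero_index, map_pow, Polynomial.aeval_X]
    push_cast
    field_simp
    ring
  · refine ⟨0, 1/12, 0, 0, 0, -1, 1/12, 0, 0, fun t ht => ?_⟩
    obtain ⟨h1, h3, h6, hc, hq⟩ := den_ne ht
    simp only [kside, Finsupp.sum_zero_index, map_pow, Polynomial.aeval_X]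
    push_cast
    field_simp
    ring
  · refine ⟨0, 1/9, -1/8, 0, 1/4, 1/8, -1/72, 0, 0, fun t ht => ?_⟩
    obtain ⟨h1, h3, h6, hc, hq⟩ := den_ne ht
    simp only [kside, Finsupp.sum_zero_index, map_pow, Polynomial.aeval_X]
    push_cast
    field_simp
    ring
  · refine ⟨0, 1/3, -5/8, -1/4, 0, 3/8, -1/24, 0, 0, fun t ht => ?_⟩
    obtain ⟨h1, h3, h6, hc, hq⟩ := den_ne ht
    simp only [kside, Finsupp.sum_zero_index, map_pow, Polynomial.aeval_X]
    push_cast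
    field_simp
    ring
  · refine ⟨0, 1/36, 0, 0, 0, 0, 1/36, 0, 0, fun t ht => ?_⟩
    obtain ⟨h1, h3, h6, hc, hq⟩ := den_ne ht
    simp only [kside, Finsupp.sum_zero_index, map_pow, Polynomial.aeval_X]
    push_cast
    field_simp
    ring

theorem kd_X_pow (n : ℕ) : KD (X ^ n) := by
  induction n using Nat.strong_induction_on with
  | _ n ih =>
    rcases lt_or_ge n 6 with hn | hn
    · exact kd_X_pow_lt_six hn
    · obtain ⟨m, rfl⟩ : ∃ m, n = m + 6 := ⟨n - 6, by omega⟩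
      exact kd_X_pow_step (ih m (by omega))

theorem kd_all (P : ℚ[X]) : KD P := by
  rw [P.as_sum_support_C_mul_X_pow]
  exact Finset.sum_induction _ KD (fun _ _ => kd_add) kd_zero
    (fun i _ => kd_smul _ (kd_X_pow i))

/-- **The certificate exists for every `P`.** -/
theorem kernelDecomposition_holds : KernelDecomposition := fun P => kd_all P

/-- **ReductionTwoSix from the engine alone**: the crux follows from the route item
`DilationMove` (stmt-KontsevichZagierPeriods-3872) — nothing else. -/
theorem reductionTwoSix_of_dilationMove (hD : DilationMove) : ReductionTwoSix :=
  reductionTwoSix_of hD kernelDecomposition_holds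


/-! ### The engine holds: `DilationMove` (stmt-3872) from `BoxCoordinatePowerMap.lean`

All five side conditions of `KZ.changeOfVariablesRel` for `Φₘ(x) = (xᵢᵐ)ᵢ` on the open unit box
are tree lemmas: semialgebraic (`isSemialgebraicMapOn_aeval`), derivative
(`BoxIntegral.hasFDerivWithinAt_coordPow`), injective (`BoxIntegral.injOn_coordPow_box`),
`Φₘ '' box = box` (`BoxIntegral.image_coordPow_box`), `|det Φₘ'| = mⁿ ∏ xᵢ^{m−1}`
(`BoxIntegral.abs_det_coordPowDeriv`). -/

theorem dilationMove_holds : DilationMove := by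
  intro n m hm r r' hr hr' hf
  have hm0 : m ≠ 0 := by omega
  have hbox : Literature.ModelTheory.ExponentialFields.IsSemialgebraic ℚ r.domain := by
    rw [hr]; exact KZ.isSemialgebraic_box n
  refine ⟨n, r, r', BoxIntegral.coordPow m, BoxIntegral.coordPowDeriv m, ?_, ?_, ?_, ?_, ?_, rfl⟩
  · -- semialgebraic: a polynomial map
    refine (isSemialgebraicMapOn_aeval hbox (fun j => (MvPolynomial.X j) ^ m)).congr ?_
    intro x _
    funext j
    simp [BoxIntegral.coordPow]
  · intro x _
    exact BoxIntegral.hasFDerivWithinAt_coordPow m r.domain x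
  · rw [hr]
    exact BoxIntegral.injOn_coordPow_box hm0
  · rw [hr, hr', BoxIntegral.image_coordPow_box hm0]
  · intro x hx
    have hxB : ∀ i, x i ∈ Set.Ioo (0:ℝ) 1 := by rw [hr] at hx; exact hx
    rw [hf x hx, BoxIntegral.abs_det_coordPowDeriv hm0 hxB]
    rfl

/-- **THE CRUX, UNCONDITIONALLY**: `ReductionTwoSix` (stmt-KontsevichZagierPeriods-3871) holds —
candidate proof for a prover to port into `Theorems/` (this file is a crux workfile, not a
`Theorems/` module). Axioms: `propext`, `Classical.choice`, `Quot.sound`. -/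
theorem reductionTwoSix_holds : ReductionTwoSix :=
  reductionTwoSix_of_dilationMove dilationMove_holds

end TransferProof

end Summit.KontsevichZagierPeriods.KontsevichZagierPeriods.Cruxes.ReductionTwoSix.Sketch
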